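import Summits.AtomisticToContinuum.Crystallization.Theorems.ChartedPlanarOrderCleanStackedIndependent
import Summits.AtomisticToContinuum.Crystallization.Theorems.ChartedPlanarOrderPlanesVirialForm
import Summits.AtomisticToContinuum.Crystallization.Theorems.ChartedPlanarOrderPlanesCollar
import Summits.AtomisticToContinuum.Crystallization.Theorems.ChartedPlanarOrderPlanesPointSums

/-!
# Slot 7b by the method of planes, module P3d: the virial of a cube chunk, truncated at range `R` (decomp-a2c lens-3 g26; critic row 523 (b))

Blocker `N = ChartedPlanarOrder.ChartedZeroExcessLayered`, leaf 7b `GapStressVanishesW (17/16)`.  For a `δ`-separated set `S` and a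
cube chunk `F = S ∩ cube c ℓ`, the pair virial form of `…PlanesVirialForm` is the double sum of the VIRIAL KERNEL

  `𝒲(F)(u,v) = Σ_{x ∈ F} Σ_{y ∈ F} K_{u,v}(x,y)`,  `K_{u,v}(x,y) = (r⁻¹⁴ − r⁻⁸) ⟪u, y − x⟫ ⟪v, y − x⟫ = ⟪u, y − x⟫ ⟪v, pairForce (y − x)⟫`

(§1).  §2: the COLUMN SUM of a site, `colSum S u v R x = Σ_{y ∈ S, dist y x ≤ R} K_{u,v}(x,y)` — the row of `x` summed over the WHOLE
configuration within range `R` (not only over the chunk).  §3 ★ THE TRUNCATION–COLLAR ESTIMATE: replacing each row of the chunk's virial by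
the column sum costs (i) the far pairs, `≤ Λ(δ)·2δ/R` per site (tail point sums of `…PlanesPointSums`), and (ii) the pairs leaving the cube,
which only occur at sites of the inner collar of width `R` (`…PlanesCollar.mem_innerCollar_of_sub`) and cost `≤ Λ(δ)` per such site:

  `|𝒲(F)(u,v) − Σ_{x ∈ F} colSum S u v R x| ≤ ‖u‖ ‖v‖ Λ(δ) (#F · 2δ/R + #(F ∩ IC_R))`,  `Λ(δ) = (δ⁻⁶ + 1)(4/δ)⁶·192`

(`abs_virialForm_sub_sum_colSum_le`).  With `#F ~ ℓ³` and `#(F ∩ IC_R) = O_R(ℓ²)` (`…PlanesCollar.card_collar_le`) this is the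
`ℓ → ∞`, then `R → ∞` bookkeeping of the virial route to 7b; the column sums themselves are rearranged BY PLANES in module P3e.

Mathlib only (+ the lens-3 modules imported); `[folklore]`; no instances, no notation, sorry-free.
-/

noncomputable section

open MeasureTheory Set Metric Filter Topology
open scoped RealInnerProductSpace
open Summit.AtomisticToContinuum.Crystallization.Theorems.ChartedPlanarOrderRigidityDoor
open Summit.AtomisticToContinuum.Crystallization.Theorems.ChartedPlanarOrderDensityDichotomy
open Summit.AtomisticToContinuum.Crystallization.Theorems.ChartedPlanarOrderMesoCut
open Summit.AtomisticToContinuum.Crystallization.Theorems.ChartedPlanarOrderProfileSlavingLJ (pairForce)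
open Summit.AtomisticToContinuum.Crystallization.Theorems.ChartedPlanarOrderCleanStackedIndependent (finite_sep_inter_closedBall)
open Summit.AtomisticToContinuum.Crystallization.Theorems.OverbindingBudgetElasticSplitDilation (enum sum_sum_enum)
open Summit.AtomisticToContinuum.Crystallization.Theorems.ChartedPlanarOrderPlanesVirialForm (virialForm)
open Summit.AtomisticToContinuum.Crystallization.Theorems.ChartedPlanarOrderPlanesCollar (cube innerCollar mem_innerCollar_of_sub)
open Summit.AtomisticToContinuum.Crystallization.Theorems.ChartedPlanarOrderPlanesPointSums (sum_inv_pow_six_le_local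
  sum_inv_pow_six_le_tail abs_kernel_le)

namespace Summit.AtomisticToContinuum.Crystallization.Theorems.ChartedPlanarOrderPlanesColumn

variable {δ : ℝ} {S : Set E3}

/-! ## 1. The virial kernel; the virial form as a double sum over the chunk -/

section Kernel

/-- the virial kernel of the ordered pair `(x, y)` tested against `u`, `v`: `(r⁻¹⁴ − r⁻⁸) ⟪u, y − x⟫ ⟪v, y − x⟫`, `r = dist x y`. -/
def vKer (u v x y : E3) : ℝ := ((dist x y)⁻¹ ^ 14 - (dist x y)⁻¹ ^ 8) * (⟪u, y - x⟫ * ⟪v, y - x⟫)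

/-- the diagonal vanishes. -/
theorem vKer_self (u v x : E3) : vKer u v x x = 0 := by simp [vKer]

/-- the virial kernel in terms of `‖x - y‖⁻¹` and the two projections of `y - x`. -/
theorem vKer_eq (u v x y : E3) : vKer u v x y = ((‖x - y‖⁻¹) ^ 14 - (‖x - y‖⁻¹) ^ 8) * (⟪u, y - x⟫ * ⟪v, y - x⟫) := by
  rw [vKer, dist_eq_norm]

/-- ★ the kernel is the `u`-moment of the `v`-component of the PAIR FORCE: `K_{u,v}(x,y) = ⟪u, y − x⟫ ⟪v, pairForce (y − x)⟫`. -/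
theorem vKer_eq_inner_pairForce (u v x y : E3) : vKer u v x y = ⟪u, y - x⟫ * ⟪v, pairForce (y - x)⟫ := by
  rw [vKer, pairForce, real_inner_smul_right, dist_eq_norm, ← norm_neg (x - y), neg_sub]
  ring

/-- the kernel is symmetric in the test vectors. -/
theorem vKer_comm (u v x y : E3) : vKer u v x y = vKer v u x y := by
  rw [vKer, vKer, mul_comm ⟪u, y - x⟫]

/-- homogeneity in the test vectors. -/
theorem vKer_smul (s t : ℝ) (u v x y : E3) : vKer (s • u) (t • v) x y = s * t * vKer u v x y := by
  rw [vKer, vKer, real_inner_smul_left, real_inner_smul_left]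
  ring

/-- the kernel bound `|K_{u,v}(x,y)| ≤ (δ⁻⁶ + 1) ‖u‖ ‖v‖ ‖x − y‖⁻⁶` at distance `≥ δ` (`…PlanesPointSums.abs_kernel_le`). -/
theorem abs_vKer_le (hδ : 0 < δ) (u v : E3) {x y : E3} (hxy : δ ≤ ‖x - y‖) :
    |vKer u v x y| ≤ ((δ⁻¹) ^ 6 + 1) * (‖u‖ * ‖v‖) * (‖x - y‖⁻¹) ^ 6 := by
  have h := abs_kernel_le hδ u v (Δ := y - x) (by rwa [norm_sub_rev])
  rw [norm_sub_rev y x] at h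
  rw [vKer_eq]
  exact h

/-- ★ the virial form is the double sum of the kernel over the chunk (the diagonal terms vanish). -/
theorem virialForm_eq_sum (F : Finset E3) (u v : E3) : virialForm F u v = ∑ x ∈ F, ∑ y ∈ F, vKer u v x y := by
  rw [← sum_sum_enum F (vKer u v)]
  unfold virialForm
  refine Finset.sum_congr rfl fun i _ => ?_
  exact Finset.sum_erase _ (vKer_self u v (enum F i))

/-- homogeneity of the virial form: `𝒲(s u, t v) = s t 𝒲(u, v)`. -/
theorem virialForm_smul (F : Finset E3) (s t : ℝ) (u v : E3) : virialForm F (s • u) (t • v) = s * t * virialForm F u v := by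
  rw [virialForm_eq_sum, virialForm_eq_sum, Finset.mul_sum]
  refine Finset.sum_congr rfl fun x _ => ?_
  rw [Finset.mul_sum]
  exact Finset.sum_congr rfl fun y _ => vKer_smul s t u v x y

end Kernel

/-! ## 2. Column sums over the whole configuration within range `R` -/

section Column

/-- the atoms of `S` within range `R` of `x`, as a finset (`∅` as junk if there were infinitely many). -/
def nbhd (S : Set E3) (x : E3) (R : ℝ) : Finset E3 := by
  classical exact if h : (S ∩ closedBall x R).Finite then h.toFinset else ∅

/-- membership (separated sets have finitely many atoms in a ball, `…CleanStackedIndependent.finite_sep_inter_closedBall`). -/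
theorem mem_nbhd (hδ : 0 < δ) (hS : IsSep δ S) {x : E3} {R : ℝ} {y : E3} : y ∈ nbhd S x R ↔ y ∈ S ∧ dist y x ≤ R := by
  rw [nbhd, dif_pos (finite_sep_inter_closedBall hδ hS x R), Set.Finite.mem_toFinset]
  rfl

/-- the finite neighbourhood `nbhd S x R` is `S ∩ closedBall x R`. -/
theorem coe_nbhd (hδ : 0 < δ) (hS : IsSep δ S) (x : E3) (R : ℝ) : (↑(nbhd S x R) : Set E3) = S ∩ closedBall x R := by
  ext y
  rw [Finset.mem_coe, mem_nbhd hδ hS]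
  rfl

/-- ★ the COLUMN SUM of the site `x`: its virial row over the whole configuration within range `R`. -/
def colSum (S : Set E3) (u v : E3) (R : ℝ) (x : E3) : ℝ := ∑ y ∈ nbhd S x R, vKer u v x y

/-- the truncation–collar constant `Λ(δ) = (δ⁻⁶ + 1)(4/δ)⁶·192`. -/
def Lam (δ : ℝ) : ℝ := ((δ⁻¹) ^ 6 + 1) * ((4 / δ) ^ 6 * 192)

/-- `Lam δ ≥ 0`. -/
theorem Lam_nonneg (hδ : 0 < δ) : 0 ≤ Lam δ := by unfold Lam; positivity

end Column

/-! ## 3. ★ The truncation–collar estimate -/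

section Estimate

variable {F : Finset E3} {c : E3} {ℓ R : ℝ}

open Classical in
/-- per site: the chunk row differs from the column sum by the far pairs (`≤ Λ·2δ/R`) and, at collar sites only, by the pairs leaving
the cube (`≤ Λ`). -/
theorem abs_row_sub_colSum_le (hδ : 0 < δ) (hS : IsSep δ S) (hF : (↑F : Set E3) = S ∩ cube c ℓ) (hR : 2 * δ ≤ R)
    (u v : E3) {x : E3} (hx : x ∈ F) :
    |∑ y ∈ F, vKer u v x y - colSum S u v R x| ≤
      ‖u‖ * ‖v‖ * Lam δ * (2 * δ / R) + (if x ∈ innerCollar c ℓ R then ‖u‖ * ‖v‖ * Lam δ else 0) := by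
  have hR0 : 0 < R := by linarith
  have hxS : x ∈ S ∧ x ∈ cube c ℓ := by
    have h := hx
    rw [← Finset.mem_coe, hF] at h
    exact h
  have hmemS : ∀ y ∈ F, y ∈ S := fun y hy => by
    have h := hy
    rw [← Finset.mem_coe, hF] at h
    exact h.1
  have hK : 0 ≤ ((δ⁻¹) ^ 6 + 1) * (‖u‖ * ‖v‖) := by positivity
  -- split the row into near and far pairs; the near pairs are the column pairs inside the cube
  have hnear : F.filter (fun y => dist y x ≤ R) = (nbhd S x R).filter (fun y => y ∈ cube c ℓ) := by
    ext y
    rw [Finset.mem_filter, Finset.mem_filter, mem_nbhd hδ hS, ← Finset.mem_coe, hF, Set.mem_inter_iff]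
    tauto
  have hsplit : ∑ y ∈ F, vKer u v x y - colSum S u v R x =
      ∑ y ∈ F.filter (fun y => ¬ dist y x ≤ R), vKer u v x y - ∑ y ∈ (nbhd S x R).filter (fun y => y ∉ cube c ℓ), vKer u v x y := by
    rw [← Finset.sum_filter_add_sum_filter_not F (fun y => dist y x ≤ R), colSum,
      ← Finset.sum_filter_add_sum_filter_not (nbhd S x R) (fun y => y ∈ cube c ℓ), hnear]
    ring
  rw [hsplit]
  -- (i) far pairs
  have hfar : |∑ y ∈ F.filter (fun y => ¬ dist y x ≤ R), vKer u v x y| ≤ ‖u‖ * ‖v‖ * Lam δ * (2 * δ / R) := by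
    refine (Finset.abs_sum_le_sum_abs _ _).trans ?_
    have h1 : ∀ y ∈ F.filter (fun y => ¬ dist y x ≤ R), |vKer u v x y| ≤ ((δ⁻¹) ^ 6 + 1) * (‖u‖ * ‖v‖) * (‖x - y‖⁻¹) ^ 6 := by
      intro y hy
      rw [Finset.mem_filter, not_le, dist_eq_norm, norm_sub_rev] at hy
      exact abs_vKer_le hδ u v (by linarith [hy.2])
    refine (Finset.sum_le_sum h1).trans ?_
    rw [← Finset.mul_sum]
    have h2 := sum_inv_pow_six_le_tail hδ hS hxS.1 (F.filter fun y => ¬ dist y x ≤ R) (fun y hy => by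
        rw [Finset.mem_filter, not_le] at hy
        refine ⟨hmemS y hy.1, fun h => ?_⟩
        rw [h, dist_self] at hy
        exact absurd hy.2 (not_lt.mpr hR0.le)) hR (fun y hy => by
        rw [Finset.mem_filter, not_le, dist_eq_norm, norm_sub_rev] at hy
        exact hy.2.le)
    calc ((δ⁻¹) ^ 6 + 1) * (‖u‖ * ‖v‖) * ∑ y ∈ F.filter (fun y => ¬ dist y x ≤ R), (‖x - y‖⁻¹) ^ 6
        ≤ ((δ⁻¹) ^ 6 + 1) * (‖u‖ * ‖v‖) * ((4 / δ) ^ 6 * 192 * (2 * δ / R)) := mul_le_mul_of_nonneg_left h2 hK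
      _ = ‖u‖ * ‖v‖ * Lam δ * (2 * δ / R) := by rw [Lam]; ring
  -- (ii) pairs leaving the cube: none unless `x` is a collar site
  have hcorr : |∑ y ∈ (nbhd S x R).filter (fun y => y ∉ cube c ℓ), vKer u v x y| ≤
      (if x ∈ innerCollar c ℓ R then ‖u‖ * ‖v‖ * Lam δ else 0) := by
    split_ifs with hxc
    · refine (Finset.abs_sum_le_sum_abs _ _).trans ?_
      have h1 : ∀ y ∈ (nbhd S x R).filter (fun y => y ∉ cube c ℓ),
          |vKer u v x y| ≤ ((δ⁻¹) ^ 6 + 1) * (‖u‖ * ‖v‖) * (‖x - y‖⁻¹) ^ 6 := by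
        intro y hy
        rw [Finset.mem_filter, mem_nbhd hδ hS] at hy
        have hne : x ≠ y := fun h => hy.2 (h ▸ hxS.2)
        have hd := hS x hxS.1 y hy.1.1 hne
        rw [dist_eq_norm] at hd
        exact abs_vKer_le hδ u v hd
      refine (Finset.sum_le_sum h1).trans ?_
      rw [← Finset.mul_sum]
      have h2 := sum_inv_pow_six_le_local hδ hS hxS.1 ((nbhd S x R).filter fun y => y ∉ cube c ℓ) (fun y hy => by
          rw [Finset.mem_filter, mem_nbhd hδ hS] at hy
          exact ⟨hy.1.1, fun h => hy.2 (h ▸ hxS.2)⟩)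
      calc ((δ⁻¹) ^ 6 + 1) * (‖u‖ * ‖v‖) * ∑ y ∈ (nbhd S x R).filter (fun y => y ∉ cube c ℓ), (‖x - y‖⁻¹) ^ 6
          ≤ ((δ⁻¹) ^ 6 + 1) * (‖u‖ * ‖v‖) * ((4 / δ) ^ 6 * 192) := mul_le_mul_of_nonneg_left h2 hK
        _ = ‖u‖ * ‖v‖ * Lam δ := by rw [Lam]; ring
    · -- no pair leaves the cube from a non-collar site
      have hempty : (nbhd S x R).filter (fun y => y ∉ cube c ℓ) = ∅ := by
        refine Finset.filter_false_of_mem fun y hy hyc => hxc ?_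
        rw [mem_nbhd hδ hS] at hy
        refine mem_innerCollar_of_sub hxS.2 (d := x - y) (by rwa [sub_sub_cancel]) ?_
        rw [← dist_eq_norm, dist_comm]
        exact hy.2
      rw [hempty, Finset.sum_empty, abs_zero]
  exact (abs_sub _ _).trans (add_le_add hfar hcorr)

open Classical in
/-- ★★ THE TRUNCATION–COLLAR ESTIMATE: `|𝒲(F)(u,v) − Σ_{x ∈ F} colSum S u v R x| ≤ ‖u‖ ‖v‖ Λ(δ) (#F · 2δ/R + #(F ∩ IC_R))`. -/
theorem abs_virialForm_sub_sum_colSum_le (hδ : 0 < δ) (hS : IsSep δ S) (hF : (↑F : Set E3) = S ∩ cube c ℓ) (hR : 2 * δ ≤ R)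
    (u v : E3) :
    |virialForm F u v - ∑ x ∈ F, colSum S u v R x| ≤
      ‖u‖ * ‖v‖ * Lam δ * ((F.card : ℝ) * (2 * δ / R) + ((F.filter fun x => x ∈ innerCollar c ℓ R).card : ℝ)) := by
  rw [virialForm_eq_sum, ← Finset.sum_sub_distrib]
  refine (Finset.abs_sum_le_sum_abs _ _).trans ?_
  refine (Finset.sum_le_sum fun x hx => abs_row_sub_colSum_le hδ hS hF hR u v hx).trans ?_
  rw [Finset.sum_add_distrib, Finset.sum_const, nsmul_eq_mul, ← Finset.sum_boole]
  have h1 : ∑ x ∈ F, (if x ∈ innerCollar c ℓ R then ‖u‖ * ‖v‖ * Lam δ else 0) =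
      ‖u‖ * ‖v‖ * Lam δ * ∑ x ∈ F, (if x ∈ innerCollar c ℓ R then (1 : ℝ) else 0) := by
    rw [Finset.mul_sum]
    exact Finset.sum_congr rfl fun x _ => by split_ifs <;> ring
  rw [h1]
  apply le_of_eq
  ring

end Estimate

end Summit.AtomisticToContinuum.Crystallization.Theorems.ChartedPlanarOrderPlanesColumn
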